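import Literature.Topology.FourManifolds.CircleFramingClassification
import Literature.Topology.FourManifolds.StraightLineIsotopyExtensionRel
import Literature.Topology.FourManifolds.OneHandleModel
import Mathlib.Analysis.SpecialFunctions.Trigonometric.ArctanDeriv
import Mathlib.Analysis.Normed.Ring.Units
import HarnessLib

/-!
# Based smooth loops in `GL⁺(3, ℝ)` over the core of a `1`-handle: deformation, relative to the
# ends, to the standard fibre twist (`π₁ SO(3) = ℤ/2`), and its ambient realisation near the core

## Part I — the deformation

Topic `Literature/Topology/FourManifolds`.  The fibre-derivative loop of the comparison map of
two `1`-handles along a common core (`OneHandleUniqueness.lean`, Hirsch, *Differential Topology*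
(1976), Ch. 4 §5, Thm. 5.3: the fibre derivative `Φ` of `g = f₁⁻¹ f₀` along the core) is a smooth
map `A : ℝ → GL(3, ℝ)` on the longitudinal coordinate which is the identity off the middle of the
core (`A x = 1` for `|x| ≥ a`).  This file deforms it, **through loops which stay the identity for
`|x| ≥ b`** (`a < b`, `1/2 ≤ b`), to the explicit twist loop
`x ↦ OneHandle.rot (OneHandle.twistAngle m x)` of `OneHandleModel.lean` for some `m ∈ {0, 1}`
(`exists_loopFamilies_twist`).  The deformation is returned as two **based loop families**
(`OneHandle.IsLoopFamily b`: a family of smooth loops of invertible operators, equal to `1` for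
`|x| ≥ b`, jointly continuous in the deformation parameter `s ∈ [0, 1]`) to be composed — the
form consumed by the step-wise ambient realisation of fibre-linear isotopies (Part II).

The homotopy-theoretic input is the tree's classification of smooth free loops
`𝕊¹ → GL⁺(3, ℝ)` (`OpLoop.exists_joined_one_or_twist`, `CircleFramingClassification.lean`;
Gompf–Stipsicz, *4-Manifolds and Kirby Calculus* (1999), §5.2: `π₁ SO(3) ≅ ℤ/2`).  To use it
relative to the ends:

* `OneHandle.circleLoopFun A` — the loop `A` **read on the circle** through the tangent of the
  half angle: `u ↦ A (u₁ / (1 + u₀))` on the right half circle, `1` on the left one (smooth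
  because `A = 1` for `|x| ≥ a`, `a < 1`), an `OpLoop` (`OneHandle.circleLoop`) of positive
  determinant (`det (A x) > 0` everywhere: it is never `0` and `1` far out);
* `OneHandle.liftAngle a b`, `OneHandle.circleParam a b` — a smooth map `ℝ → 𝕊¹`, equal to
  `x ↦ (cos, sin)(2 arctan x)` for `|x| ≤ a` and **constant `= ptB` for `|x| ≥ b`**, along which
  `circleLoopFun A` pulls back to `A` *exactly* (`circleLoopFun_circleParam`);
* `OneHandle.famJ` — a free `OpLoop.Joined` family `F_s` pulled back along `circleParam` and
  **based at `ptB`**, `x ↦ F_s(ptB)⁻¹ F_s(circleParam x)`: a based loop family from `A` to the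
  pull-back of the end loop (`1`, or the twist read through `circleParam`, which is the rotation
  about the third axis through `liftAngle x + π`);
* `OneHandle.perm` — the cyclic permutation of the axes conjugating rotations about the third axis
  to `OneHandle.rot` (rotations about the first axis); the classification is applied to
  `perm⁻¹ A perm`;
* `OneHandle.famR` — the final interpolation of rotation ANGLES from `liftAngle x + π` to
  `twistAngle 1 x` (both `0` left of `-b` and `2π` right of `b`).

Everything here is proved; the definitions are explicit functions; no named fact is introduced.

## Part II — Fibre-linear self-maps of the model `1`-handle and the ambient realisation, near the
## core and relative to the ends, of a deformation of fibre-linear loops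

After the comparison map of the two handles has been linearised along the core
(`OneHandleUniquenessProofs.lean`), what is left is a smooth loop `x ↦ A(x) ∈ GL(3, ℝ)` of fibre
operators, deformed relative to the ends to the standard twist by Part I.  Here such a deformation
(an `OneHandle.IsLoopFamily`) is **realised by a compactly supported diffeomorphism of `ℝ⁴` near
the core arc**:

* `OneHandle.linMap B p = (p₀, B(p₀) (p₁, p₂, p₃))` — the fibre-linear self-map of `ℝ⁴` of a
  loop `B`, with its derivative `OneHandle.linMapDeriv` along the core arc
  `OneHandle.coreArc = {|p₀| ≤ 1, fibre = 0}`;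
* `OneHandle.exists_diffeomorph_linMap_step` — **one near-identity step**: if
  `‖C(x) B(x)⁻¹ - 1‖ < 1` for all `x`, the straight-line isotopy from `id` to
  `P = linMap (C B⁻¹)` has injective differential along the core (it is the identity in the
  longitudinal direction and `1 + t (C B⁻¹ - 1)` in the fibre), so the tree's isotopy extension
  for straight-line isotopies (`exists_diffeomorph_eqOn_nhdsSet_of_straightLine_rel`,
  `StraightLineIsotopyExtensionRel.lean`, Hirsch Ch. 8 §1, Thms. 1.3–1.4) gives a diffeomorphism
  `Q` of `ℝ⁴` with `Q ∘ linMap B = linMap C` near the core, `Q = id` off a prescribed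
  neighbourhood `O` of the core and **`Q = id` on any set `Cs` of points with `|p₀| ≥ c₀`** when
  `B = C = 1` for `|x| ≥ c₀` (the tracks of `P` preserve `p₀`, so only stationary tracks visit
  `Cs`);
* `OneHandle.exists_diffeomorph_linMap_of_isLoopFamily` — **the whole deformation**: a based loop
  family `B_s` (jointly continuous, each loop smooth, `= 1` for `|x| ≥ b`) is cut by uniform
  continuity into finitely many near-identity steps, whose diffeomorphisms compose to `Q` with
  `Q ∘ linMap (B 0) = linMap (B 1)` near the core, `Q = id` off `O` and on `Cs`
  (Gompf–Stipsicz, *4-Manifolds and Kirby Calculus* (1999), §5.2: homotopic framings give the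
  same handle attachment; Hirsch (1976), Ch. 4 §5, proof of Thm. 5.3).

Everything here is proved; the definitions are explicit functions; no named fact is introduced.

## References

* M. W. Hirsch, *Differential Topology*, GTM 33, Springer (1976), Ch. 4 §5, Thm. 5.3 (the fibre
  derivative of the comparison of two tubular neighbourhoods); Ch. 8 §1, Thms. 1.3–1.4 (isotopy
  extension). [HirschDT1976]
* R. E. Gompf, A. I. Stipsicz, *4-Manifolds and Kirby Calculus*, GSM 20 (1999), §5.2
  (`π₁ SO(3) = ℤ/2`; the two framings of a circle in a `4`-manifold). [GompfStipsiczGSM1999]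
-/

noncomputable section

open Set Function Filter Metric Real Topology
open scoped Manifold ContDiff

namespace Literature.Topology.FourManifolds

/-- Local notation: `𝔼 n` is the model Euclidean space `EuclideanSpace ℝ (Fin n)`. -/
local notation "𝔼 " n:arg => EuclideanSpace ℝ (Fin n)

/-- Local notation: `𝕊 n` is the unit sphere in `EuclideanSpace ℝ (Fin (n + 1))`. -/
local notation "𝕊 " n:arg => (Metric.sphere (0 : EuclideanSpace ℝ (Fin (n + 1))) 1)

namespace OneHandle

/-! ## Part I — based loops over the core: deformation to the standard twist -/

/-! ### Based loop families -/

/-- **A based loop family**: a family `B s`, `s ∈ ℝ` (only `[0, 1]` matters), of smooth loops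
`x ↦ B s x` of invertible operators on `ℝ³` which are the identity for `|x| ≥ b` (all `s`),
jointly continuous on `[0, 1] × ℝ`.  (Gompf–Stipsicz §5.2: a homotopy of framings; here relative
to the ends of the core arc.) [cite: GompfStipsiczGSM1999, §5.2] -/
structure IsLoopFamily (b : ℝ) (B : ℝ → ℝ → (𝔼 3 →L[ℝ] 𝔼 3)) : Prop where
  /-- each loop is smooth -/
  contDiff : ∀ s, ContDiff ℝ ∞ (B s)
  /-- the family is jointly continuous on `[0, 1] × ℝ` -/
  continuousOn : ContinuousOn (uncurry B) (Icc (0 : ℝ) 1 ×ˢ univ)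
  /-- the operators are invertible -/
  isUnit : ∀ s x, IsUnit (B s x)
  /-- the loops are based: the identity for `|x| ≥ b` -/
  eq_one : ∀ s x, b ≤ |x| → B s x = 1

/-- The constant family at the identity loop is a based loop family. [folklore] -/
theorem isLoopFamily_one (b : ℝ) : IsLoopFamily b fun _ _ => (1 : 𝔼 3 →L[ℝ] 𝔼 3) where
  contDiff _ := contDiff_const
  continuousOn := continuousOn_const
  isUnit _ _ := isUnit_one
  eq_one _ _ _ := rfl

/-! ### Positivity of the determinant of a loop of units through the identity -/

/-- A unit of the operator algebra has nonzero determinant. [folklore] -/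
theorem det_ne_zero_of_isUnit {f : 𝔼 3 →L[ℝ] 𝔼 3} (hf : IsUnit f) :
    LinearMap.det (f : 𝔼 3 →ₗ[ℝ] 𝔼 3) ≠ 0 := by
  obtain ⟨u, rfl⟩ := hf
  intro h
  have h1 : LinearMap.det ((u : 𝔼 3 →L[ℝ] 𝔼 3) : 𝔼 3 →ₗ[ℝ] 𝔼 3) *
      LinearMap.det ((↑u⁻¹ : 𝔼 3 →L[ℝ] 𝔼 3) : 𝔼 3 →ₗ[ℝ] 𝔼 3) = 1 := by
    rw [← map_mul, show ((u : 𝔼 3 →L[ℝ] 𝔼 3) : 𝔼 3 →ₗ[ℝ] 𝔼 3) *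
      ((↑u⁻¹ : 𝔼 3 →L[ℝ] 𝔼 3) : 𝔼 3 →ₗ[ℝ] 𝔼 3) = ((u * u⁻¹ : (𝔼 3 →L[ℝ] 𝔼 3)ˣ) :
        𝔼 3 →L[ℝ] 𝔼 3) from rfl, mul_inv_cancel]
    exact map_one _
  rw [h, zero_mul] at h1
  exact zero_ne_one h1

/-- **A continuous path of invertible operators passing through the identity has positive
determinant everywhere** (the determinant is continuous, never zero, and `1` somewhere;
intermediate value theorem). [folklore] -/
theorem det_pos_of_isUnit_of_eq_one {A : ℝ → (𝔼 3 →L[ℝ] 𝔼 3)} (hA : Continuous A)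
    (hAu : ∀ x, IsUnit (A x)) {x₀ : ℝ} (h1 : A x₀ = 1) (x : ℝ) :
    0 < LinearMap.det (A x : 𝔼 3 →ₗ[ℝ] 𝔼 3) := by
  set f : ℝ → ℝ := fun y => LinearMap.det (A y : 𝔼 3 →ₗ[ℝ] 𝔼 3) with hf
  have hfc : Continuous f := OpLoop.continuous_det_clm.comp hA
  have hf0 : f x₀ = 1 := by simp [hf, h1]
  by_contra hx
  have hx' : f x ≤ 0 := not_lt.1 hx
  -- a zero of `f` between `x` and `x₀`
  have hmem : (0 : ℝ) ∈ uIcc (f x) (f x₀) := by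
    rw [hf0, mem_uIcc]; exact Or.inl ⟨hx', zero_le_one⟩
  obtain ⟨c, -, hc⟩ := intermediate_value_uIcc hfc.continuousOn hmem
  exact det_ne_zero_of_isUnit (hAu c) hc

/-! ### The loop read on the circle -/

/-- The tangent of the half angle as a function of the point `u = (cos φ, sin φ)` of the circle:
`u₁ / (1 + u₀) = tan(φ/2)`. [folklore] -/
def halfTan (u : 𝔼 2) : ℝ := u 1 / (1 + u 0)

/-- `halfTan` is smooth off the point `(-1, 0)`. [folklore] -/
theorem contDiffAt_halfTan {u : 𝔼 2} (hu : 1 + u 0 ≠ 0) : ContDiffAt ℝ ∞ halfTan u := by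
  have h1 : ContDiff ℝ ∞ fun v : 𝔼 2 => v 1 := (EuclideanSpace.proj (𝕜 := ℝ) (1 : Fin 2)).contDiff
  have h0 : ContDiff ℝ ∞ fun v : 𝔼 2 => 1 + v 0 :=
    contDiff_const.add (EuclideanSpace.proj (𝕜 := ℝ) (0 : Fin 2)).contDiff
  exact h1.contDiffAt.div h0.contDiffAt hu

/-- On the circle, `halfTan² (1 + u₀) = 1 - u₀` (from `u₀² + u₁² = 1`). [folklore] -/
theorem halfTan_sq (u : 𝕊 1) (hu : 1 + (u : 𝔼 2) 0 ≠ 0) :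
    halfTan u ^ 2 = (1 - (u : 𝔼 2) 0) / (1 + (u : 𝔼 2) 0) := by
  have h := OpLoop.sq_add_sq_of_mem_sphere u
  rw [halfTan, div_pow, eq_div_iff hu]
  field_simp
  nlinarith [h]

/-- The tangent of the half angle of `(cos 2θ, sin 2θ)` is `tan θ` (where `cos θ ≠ 0`).
[folklore] -/
theorem halfTan_circlePoint_two_mul (θ : ℝ) (hc : Real.cos θ ≠ 0) :
    halfTan (circlePoint (2 * θ)) = Real.tan θ := by
  rw [halfTan, circlePoint_apply_zero, circlePoint_apply_one, Real.sin_two_mul, Real.cos_two_mul,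
    Real.tan_eq_sin_div_cos]
  have hd : (1 : ℝ) + (2 * Real.cos θ ^ 2 - 1) = 2 * Real.cos θ ^ 2 := by ring
  rw [hd, div_eq_div_iff (mul_ne_zero two_ne_zero (pow_ne_zero 2 hc)) hc]
  ring

/-- **The loop `A` read on the circle**: `A (tan (φ/2))` on the open right half circle, the
identity on the closed left one. [cite: GompfStipsiczGSM1999, §5.2] -/
def circleLoopFun (A : ℝ → (𝔼 3 →L[ℝ] 𝔼 3)) (u : 𝕊 1) : 𝔼 3 →L[ℝ] 𝔼 3 :=
  if (u : 𝔼 2) 0 ≤ 0 then 1 else A (halfTan u)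

/-- On the right half circle the loop is `A (halfTan u)`. [folklore] -/
theorem circleLoopFun_of_pos (A : ℝ → (𝔼 3 →L[ℝ] 𝔼 3)) {u : 𝕊 1} (hu : 0 < (u : 𝔼 2) 0) :
    circleLoopFun A u = A (halfTan u) := by
  simp [circleLoopFun, not_le.2 hu]

/-- The loop read on the circle is the identity on the arc `u₀ ≤ (1 - a²)/(1 + a²)` around the
left point, if `A = 1` for `|x| ≥ a`. [folklore] -/
theorem circleLoopFun_eq_one {A : ℝ → (𝔼 3 →L[ℝ] 𝔼 3)} {a : ℝ} (ha : 0 ≤ a)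
    (hAI : ∀ x, a ≤ |x| → A x = 1) {u : 𝕊 1} (hu : (u : 𝔼 2) 0 * (1 + a ^ 2) ≤ 1 - a ^ 2) :
    circleLoopFun A u = 1 := by
  by_cases h0 : (u : 𝔼 2) 0 ≤ 0
  · simp [circleLoopFun, h0]
  · rw [not_le] at h0
    rw [circleLoopFun_of_pos A h0]
    apply hAI
    have hne : 1 + (u : 𝔼 2) 0 ≠ 0 := by linarith
    have hsq : a ^ 2 ≤ halfTan u ^ 2 := by
      rw [halfTan_sq u hne, le_div_iff₀ (by linarith)]
      nlinarith
    simpa [abs_of_nonneg ha] using (sq_le_sq.1 hsq)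

/-- The loop read on the circle consists of units. [folklore] -/
theorem isUnit_circleLoopFun {A : ℝ → (𝔼 3 →L[ℝ] 𝔼 3)} (hAu : ∀ x, IsUnit (A x)) (u : 𝕊 1) :
    IsUnit (circleLoopFun A u) := by
  by_cases h0 : (u : 𝔼 2) 0 ≤ 0
  · simp [circleLoopFun, h0]
  · simp [circleLoopFun, h0, hAu]

/-- **The loop read on the circle is smooth** when `A` is smooth and `A = 1` for `|x| ≥ a`,
`0 ≤ a < 1`: near the left point it is constant, elsewhere it is `A ∘ halfTan`. [folklore] -/
theorem contMDiff_circleLoopFun {A : ℝ → (𝔼 3 →L[ℝ] 𝔼 3)} (hA : ContDiff ℝ ∞ A) {a : ℝ}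
    (ha : 0 ≤ a) (ha1 : a < 1) (hAI : ∀ x, a ≤ |x| → A x = 1) :
    ContMDiff (𝓡 1) 𝓘(ℝ, 𝔼 3 →L[ℝ] 𝔼 3) ∞ (circleLoopFun A) := by
  haveI := Fact.mk (@finrank_euclideanSpace_fin ℝ _ 2)
  set τ : ℝ := (1 - a ^ 2) / (1 + a ^ 2) with hτ
  have ha2 : a ^ 2 < 1 := by nlinarith
  have hτpos : 0 < τ := div_pos (by linarith) (by positivity)
  have hcoord : Continuous fun w : 𝕊 1 => (w : 𝔼 2) 0 := OpLoop.continuous_coord 0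
  intro u
  by_cases hu : (u : 𝔼 2) 0 < τ
  · -- near `u` the loop is constant `1`
    have hev : circleLoopFun A =ᶠ[𝓝 u] fun _ => 1 := by
      filter_upwards [(isOpen_lt hcoord continuous_const).mem_nhds hu] with w hw
      refine circleLoopFun_eq_one ha hAI ?_
      have : (w : 𝔼 2) 0 * (1 + a ^ 2) < τ * (1 + a ^ 2) :=
        mul_lt_mul_of_pos_right hw (by positivity)
      rw [hτ, div_mul_cancel₀ _ (by positivity)] at this
      exact this.le
    exact contMDiffAt_const.congr_of_eventuallyEq hev
  · -- near `u` the loop is `A ∘ halfTan`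
    rw [not_lt] at hu
    have hu0 : 0 < (u : 𝔼 2) 0 := hτpos.trans_le hu
    have hev : circleLoopFun A =ᶠ[𝓝 u] fun w => A (halfTan w) := by
      filter_upwards [(isOpen_lt continuous_const hcoord).mem_nhds hu0] with w hw
      exact circleLoopFun_of_pos A hw
    refine ContMDiffAt.congr_of_eventuallyEq ?_ hev
    have h1 : ContDiffAt ℝ ∞ (fun v : 𝔼 2 => A (halfTan v)) (u : 𝔼 2) :=
      hA.contDiffAt.comp _ (contDiffAt_halfTan (by linarith))
    exact h1.comp_contMDiffAt (contMDiff_coe_sphere u)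

/-- **The loop read on the circle, as an `OpLoop`.** [cite: GompfStipsiczGSM1999, §5.2] -/
def circleLoop {A : ℝ → (𝔼 3 →L[ℝ] 𝔼 3)} (hA : ContDiff ℝ ∞ A) {a : ℝ} (ha : 0 ≤ a)
    (ha1 : a < 1) (hAI : ∀ x, a ≤ |x| → A x = 1) (hAu : ∀ x, IsUnit (A x)) : OpLoop :=
  OpLoop.ofUnits (circleLoopFun A) (contMDiff_circleLoopFun hA ha ha1 hAI) (isUnit_circleLoopFun hAu)

/-! ### Coordinates of the two base points -/

/-- `ptA = (1, 0)`: first coordinate. [folklore] -/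
theorem ptA_apply_zero : (ptA : 𝔼 2) 0 = 1 := by
  rw [ptA, circlePt_eq_circlePoint, circlePoint_apply_zero, mul_zero, Real.cos_zero]

/-- `ptA = (1, 0)`: second coordinate. [folklore] -/
theorem ptA_apply_one : (ptA : 𝔼 2) 1 = 0 := by
  rw [ptA, circlePt_eq_circlePoint, circlePoint_apply_one, mul_zero, Real.sin_zero]

/-- `ptB = (-1, 0)`: first coordinate. [folklore] -/
theorem ptB_apply_zero : (ptB : 𝔼 2) 0 = -1 := by
  rw [ptB, circlePt_eq_circlePoint, circlePoint_apply_zero,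
    show 2 * π * (1 / 2) = π by ring, Real.cos_pi]

/-- `ptB = (-1, 0)`: second coordinate. [folklore] -/
theorem ptB_apply_one : (ptB : 𝔼 2) 1 = 0 := by
  rw [ptB, circlePt_eq_circlePoint, circlePoint_apply_one,
    show 2 * π * (1 / 2) = π by ring, Real.sin_pi]

/-- `ptB = circlePoint π`. [folklore] -/
theorem ptB_eq_circlePoint_pi : ptB = circlePoint π := by
  rw [ptB, circlePt_eq_circlePoint, show 2 * π * (1 / 2) = π by ring]

/-- The loop read on the circle takes the value `A 0` at `ptA`. [folklore] -/
theorem circleLoopFun_ptA (A : ℝ → (𝔼 3 →L[ℝ] 𝔼 3)) : circleLoopFun A ptA = A 0 := by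
  rw [circleLoopFun_of_pos A (by rw [ptA_apply_zero]; exact one_pos), halfTan, ptA_apply_one,
    zero_div]

/-- The loop read on the circle is the identity at `ptB`. [folklore] -/
theorem circleLoopFun_ptB (A : ℝ → (𝔼 3 →L[ℝ] 𝔼 3)) : circleLoopFun A ptB = 1 := by
  simp [circleLoopFun, ptB_apply_zero]

/-! ### The pull-back parametrisation of the circle -/

/-- Cut-off `0` for `x ≤ a`, `1` for `x ≥ b`. [folklore] -/
def cutPlus (a b x : ℝ) : ℝ := Real.smoothTransition ((x - a) / (b - a))

/-- Cut-off `0` for `x ≥ -a`, `1` for `x ≤ -b`. [folklore] -/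
def cutMinus (a b x : ℝ) : ℝ := Real.smoothTransition ((-x - a) / (b - a))

/-- **The lifted angle**: `2 arctan x` for `|x| ≤ a`, `π` for `x ≥ b`, `-π` for `x ≤ -b`, and
in between a convex combination of `2 arctan x` and `±π`. [folklore] -/
def liftAngle (a b x : ℝ) : ℝ :=
  2 * arctan x + cutPlus a b x * (π - 2 * arctan x) + cutMinus a b x * (-π - 2 * arctan x)

/-- **The pull-back parametrisation** `x ↦ (cos, sin)(liftAngle x)` of the circle. [folklore] -/
def circleParam (a b x : ℝ) : 𝕊 1 := circlePoint (liftAngle a b x)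

section Param

variable {a b : ℝ}

/-- The right cut-off is smooth. [folklore] -/
theorem contDiff_cutPlus : ContDiff ℝ ∞ (cutPlus a b) :=
  Real.smoothTransition.contDiff.comp ((contDiff_id.sub contDiff_const).div_const _)

/-- The left cut-off is smooth. [folklore] -/
theorem contDiff_cutMinus : ContDiff ℝ ∞ (cutMinus a b) :=
  Real.smoothTransition.contDiff.comp ((contDiff_neg.sub contDiff_const).div_const _)

/-- The lifted angle is smooth. [folklore] -/
theorem contDiff_liftAngle : ContDiff ℝ ∞ (liftAngle a b) := by
  have h2 : ContDiff ℝ ∞ fun x : ℝ => 2 * arctan x := contDiff_const.mul contDiff_arctan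
  unfold liftAngle
  exact (h2.add (contDiff_cutPlus.mul (contDiff_const.sub h2))).add
    (contDiff_cutMinus.mul (contDiff_const.sub h2))

/-- The right cut-off vanishes left of `a`. [folklore] -/
theorem cutPlus_of_le (hab : a < b) {x : ℝ} (hx : x ≤ a) : cutPlus a b x = 0 :=
  Real.smoothTransition.zero_of_nonpos (div_nonpos_of_nonpos_of_nonneg (by linarith) (by linarith))

/-- The right cut-off is `1` right of `b`. [folklore] -/
theorem cutPlus_of_ge (hab : a < b) {x : ℝ} (hx : b ≤ x) : cutPlus a b x = 1 :=
  Real.smoothTransition.one_of_one_le ((one_le_div (by linarith)).2 (by linarith))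

/-- The left cut-off vanishes right of `-a`. [folklore] -/
theorem cutMinus_of_ge (hab : a < b) {x : ℝ} (hx : -a ≤ x) : cutMinus a b x = 0 :=
  Real.smoothTransition.zero_of_nonpos (div_nonpos_of_nonpos_of_nonneg (by linarith) (by linarith))

/-- The left cut-off is `1` left of `-b`. [folklore] -/
theorem cutMinus_of_le (hab : a < b) {x : ℝ} (hx : x ≤ -b) : cutMinus a b x = 1 :=
  Real.smoothTransition.one_of_one_le ((one_le_div (by linarith)).2 (by linarith))

/-- For `|x| ≤ a` the lifted angle is `2 arctan x`. [folklore] -/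
theorem liftAngle_of_abs_le (hab : a < b) {x : ℝ} (hx : |x| ≤ a) :
    liftAngle a b x = 2 * arctan x := by
  rw [abs_le] at hx
  rw [liftAngle, cutPlus_of_le hab hx.2, cutMinus_of_ge hab hx.1]; ring

/-- The pull-back parametrisation is smooth. [folklore] -/
theorem contMDiff_circleParam : ContMDiff 𝓘(ℝ, ℝ) (𝓡 1) ∞ (circleParam a b) :=
  contMDiff_circlePoint.comp contDiff_liftAngle.contMDiff

/-- The pull-back parametrisation is continuous. [folklore] -/
theorem continuous_circleParam : Continuous (circleParam a b) :=
  contMDiff_circleParam.continuous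

variable (ha : 0 < a) (hab : a < b)
include ha hab

/-- For `x ≥ b` the lifted angle is `π`. [folklore] -/
theorem liftAngle_of_ge {x : ℝ} (hx : b ≤ x) : liftAngle a b x = π := by
  rw [liftAngle, cutPlus_of_ge hab hx, cutMinus_of_ge hab (by linarith)]; ring

/-- For `x ≤ -b` the lifted angle is `-π`. [folklore] -/
theorem liftAngle_of_le {x : ℝ} (hx : x ≤ -b) : liftAngle a b x = -π := by
  rw [liftAngle, cutPlus_of_le hab (by linarith), cutMinus_of_le hab hx]; ring

/-- For `x ≥ a` the lifted angle lies between `2 arctan x` and `π`. [folklore] -/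
theorem liftAngle_mem_of_ge {x : ℝ} (hx : a ≤ x) : liftAngle a b x ∈ Icc (2 * arctan x) π := by
  have hc0 : 0 ≤ cutPlus a b x := Real.smoothTransition.nonneg _
  have hc1 : cutPlus a b x ≤ 1 := Real.smoothTransition.le_one _
  have hat : 2 * arctan x < π := by linarith [arctan_lt_pi_div_two x]
  rw [liftAngle, cutMinus_of_ge hab (by linarith), zero_mul, add_zero]
  constructor <;> nlinarith

/-- For `x ≤ -a` the lifted angle lies between `-π` and `2 arctan x`. [folklore] -/
theorem liftAngle_mem_of_le {x : ℝ} (hx : x ≤ -a) : liftAngle a b x ∈ Icc (-π) (2 * arctan x) := by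
  have hc0 : 0 ≤ cutMinus a b x := Real.smoothTransition.nonneg _
  have hc1 : cutMinus a b x ≤ 1 := Real.smoothTransition.le_one _
  have hat : -π < 2 * arctan x := by linarith [neg_pi_div_two_lt_arctan x]
  rw [liftAngle, cutPlus_of_le hab (by linarith), zero_mul, add_zero]
  constructor <;> nlinarith

/-- **For `|x| ≥ a`: `2 arctan a ≤ |liftAngle x| ≤ π`.** [folklore] -/
theorem abs_liftAngle_mem {x : ℝ} (hx : a ≤ |x|) :
    |liftAngle a b x| ∈ Icc (2 * arctan a) π := by
  rcases le_or_gt 0 x with h0 | h0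
  · rw [abs_of_nonneg h0] at hx
    obtain ⟨h1, h2⟩ := liftAngle_mem_of_ge ha hab hx
    have hpos : 0 ≤ 2 * arctan x := by
      have := arctan_strictMono.monotone h0; rw [arctan_zero] at this; linarith
    rw [abs_of_nonneg (hpos.trans h1)]
    exact ⟨(mul_le_mul_of_nonneg_left (arctan_strictMono.monotone hx) zero_le_two).trans h1, h2⟩
  · rw [abs_of_neg h0] at hx
    obtain ⟨h1, h2⟩ := liftAngle_mem_of_le ha hab (by linarith : x ≤ -a)
    have hneg : 2 * arctan x ≤ 0 := by
      have := arctan_strictMono.monotone h0.le; rw [arctan_zero] at this; linarith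
    rw [abs_of_nonpos (h2.trans hneg)]
    refine ⟨?_, by linarith⟩
    have := arctan_strictMono.monotone hx
    rw [arctan_neg] at this
    linarith

/-- **The pull-back parametrisation is constant `= ptB` for `|x| ≥ b`.** [folklore] -/
theorem circleParam_of_le_abs {x : ℝ} (hx : b ≤ |x|) : circleParam a b x = ptB := by
  rw [circleParam, ptB_eq_circlePoint_pi]
  rcases le_or_gt 0 x with h0 | h0
  · rw [abs_of_nonneg h0] at hx
    rw [liftAngle_of_ge ha hab hx]
  · rw [abs_of_neg h0] at hx
    rw [liftAngle_of_le ha hab (by linarith), ← circlePoint_add_two_pi]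
    congr 1; ring

/-- The pull-back parametrisation maps `0` to `ptA`. [folklore] -/
theorem circleParam_zero : circleParam a b 0 = ptA := by
  rw [circleParam, liftAngle_of_abs_le hab (by rw [abs_zero]; exact ha.le), arctan_zero,
    mul_zero, ptA, circlePt_eq_circlePoint, mul_zero]

/-- **The loop read on the circle pulls back to `A` along the parametrisation**, if `A = 1`
for `|x| ≥ a` and `a < 1`. [folklore] -/
theorem circleLoopFun_circleParam {A : ℝ → (𝔼 3 →L[ℝ] 𝔼 3)} (ha1 : a < 1)
    (hAI : ∀ x, a ≤ |x| → A x = 1) (x : ℝ) :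
    circleLoopFun A (circleParam a b x) = A x := by
  rcases le_or_gt a |x| with hx | hx
  · -- far out: both sides are `1`
    rw [hAI x hx]
    refine circleLoopFun_eq_one ha.le hAI ?_
    -- `cos (liftAngle x) ≤ cos (2 arctan a) = (1 - a²)/(1 + a²)`
    have hmem := abs_liftAngle_mem ha hab hx
    have hcos : Real.cos (liftAngle a b x) ≤ Real.cos (2 * arctan a) := by
      rw [← Real.cos_abs (liftAngle a b x)]
      have h0 : 0 ≤ 2 * arctan a := by
        have := arctan_strictMono.monotone ha.le; rw [arctan_zero] at this; linarith
      exact Real.strictAntiOn_cos.antitoneOn ⟨h0, by linarith [hmem.2, hmem.1]⟩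
        ⟨h0.trans hmem.1, hmem.2⟩ hmem.1
    have hval : Real.cos (2 * arctan a) * (1 + a ^ 2) = 1 - a ^ 2 := by
      rw [Real.cos_two_mul, cos_sq_arctan]
      field_simp
      ring
    show (circlePoint (liftAngle a b x) : 𝔼 2) 0 * (1 + a ^ 2) ≤ 1 - a ^ 2
    rw [circlePoint_apply_zero, ← hval]
    exact mul_le_mul_of_nonneg_right hcos (by positivity)
  · -- in the middle: the tangent of the half angle of `2 arctan x` is `x`
    have hx' : |x| ≤ a := hx.le
    set θ := arctan x with hθ
    have hcpos : 0 < Real.cos θ := cos_arctan_pos x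
    have hcsq : Real.cos θ ^ 2 = 1 / (1 + x ^ 2) := cos_sq_arctan x
    have hx1 : x ^ 2 < 1 := by
      have : |x| < 1 := hx.trans ha1
      nlinarith [abs_nonneg x, sq_abs x]
    have hcos2 : 0 < Real.cos (2 * θ) := by
      rw [Real.cos_two_mul, hcsq]
      rw [div_eq_mul_inv, one_mul]
      have : (1 + x ^ 2)⁻¹ > 1 / 2 := by
        rw [gt_iff_lt, one_div, inv_lt_inv₀ (by positivity) (by positivity)]; linarith
      linarith
    have hpos : 0 < ((circleParam a b x : 𝕊 1) : 𝔼 2) 0 := by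
      rw [circleParam, liftAngle_of_abs_le hab hx', circlePoint_apply_zero]; exact hcos2
    rw [circleLoopFun_of_pos A hpos]
    congr 1
    rw [circleParam, liftAngle_of_abs_le hab hx', halfTan_circlePoint_two_mul θ hcpos.ne', hθ,
      tan_arctan]

end Param

/-! ### Rotations about the third axis, the axis permutation -/

/-- The matrix of the rotation of `ℝ³` about its third axis through `α`. [folklore] -/
def rotZMat (α : ℝ) : Matrix (Fin 3) (Fin 3) ℝ :=
  !![Real.cos α, -Real.sin α, 0; Real.sin α, Real.cos α, 0; 0, 0, 1]

/-- The rotation of `ℝ³` about its third axis through `α`, as an operator. [folklore] -/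
def rotZ (α : ℝ) : 𝔼 3 →L[ℝ] 𝔼 3 := matCLM (rotZMat α)

/-- **The twist read through a circle point, based at `ptB`, is the rotation about the third
axis through the angle plus `π`**: `twist(ptB)⁻¹ twist(circlePoint φ) = rotZ (φ + π)`. [folklore] -/
theorem twist_inv_ptB_mul_twist_circlePoint (φ : ℝ) :
    OpLoop.twist.inv ptB * OpLoop.twist.toFun (circlePoint φ) = rotZ (φ + π) := by
  show matCLM (OpLoop.rotMatInv (ptB : 𝔼 2)) * matCLM (OpLoop.rotMat (circlePoint φ : 𝔼 2)) =
    matCLM (rotZMat (φ + π))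
  rw [← matCLM_mul]
  congr 1
  ext i j
  fin_cases i <;> fin_cases j <;>
    simp [OpLoop.rotMatInv, OpLoop.rotMat, rotZMat, ptB_apply_zero, ptB_apply_one,
      Matrix.mul_apply, Fin.sum_univ_three, Real.cos_add_pi, Real.sin_add_pi]

/-- The cyclic permutation of the axes `(v₀, v₁, v₂) ↦ (v₂, v₀, v₁)` (matrix). [folklore] -/
def permMat : Matrix (Fin 3) (Fin 3) ℝ := !![0, 0, 1; 1, 0, 0; 0, 1, 0]

/-- The inverse cyclic permutation (matrix). [folklore] -/
def permInvMat : Matrix (Fin 3) (Fin 3) ℝ := !![0, 1, 0; 0, 0, 1; 1, 0, 0]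

/-- The cyclic permutation of the axes, as an operator. [folklore] -/
def perm : 𝔼 3 →L[ℝ] 𝔼 3 := matCLM permMat

/-- Its inverse. [folklore] -/
def permInv : 𝔼 3 →L[ℝ] 𝔼 3 := matCLM permInvMat

/-- `perm · permInv = 1`. [folklore] -/
theorem perm_mul_permInv : perm * permInv = 1 := by
  rw [perm, permInv, ← matCLM_mul, ← matCLM_one]
  congr 1
  ext i j
  fin_cases i <;> fin_cases j <;> simp [permMat, permInvMat, Matrix.mul_apply, Fin.sum_univ_three]

/-- `permInv · perm = 1`. [folklore] -/
theorem permInv_mul_perm : permInv * perm = 1 := by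
  rw [perm, permInv, ← matCLM_mul, ← matCLM_one]
  congr 1
  ext i j
  fin_cases i <;> fin_cases j <;> simp [permMat, permInvMat, Matrix.mul_apply, Fin.sum_univ_three]

/-- The axis permutation is invertible. [folklore] -/
theorem isUnit_perm : IsUnit perm := ⟨⟨perm, permInv, perm_mul_permInv, permInv_mul_perm⟩, rfl⟩

/-- The inverse axis permutation is invertible. [folklore] -/
theorem isUnit_permInv : IsUnit permInv :=
  ⟨⟨permInv, perm, permInv_mul_perm, perm_mul_permInv⟩, rfl⟩

/-- `OneHandle.rot` is `matCLM` of `rotMat3`. [folklore] -/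
theorem rot_eq_matCLM (α : ℝ) : rot α = matCLM (rotMat3 α) := rfl

/-- **Conjugation by the axis permutation turns rotations about the third axis into rotations
about the first axis.** [folklore] -/
theorem perm_mul_rotZ_mul_permInv (α : ℝ) : perm * rotZ α * permInv = rot α := by
  rw [perm, rotZ, permInv, rot_eq_matCLM, ← matCLM_mul, ← matCLM_mul]
  congr 1
  ext i j
  fin_cases i <;> fin_cases j <;>
    simp [permMat, permInvMat, rotZMat, rotMat3, Matrix.mul_apply, Fin.sum_univ_three]

/-- Conjugation cancels: `perm (permInv T perm) permInv = T`. [folklore] -/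
theorem perm_conj_permInv_conj (T : 𝔼 3 →L[ℝ] 𝔼 3) :
    perm * (permInv * T * perm) * permInv = T := by
  rw [show perm * (permInv * T * perm) * permInv = (perm * permInv) * T * (perm * permInv) by
    noncomm_ring, perm_mul_permInv, one_mul, mul_one]

/-! ### Families: pulled-back joined families, conjugated families, the angle family -/

/-- An `OpLoop` has invertible inverse operators. [folklore] -/
theorem _root_.Literature.Topology.FourManifolds.OpLoop.isUnit_inv (L : OpLoop) (u : 𝕊 1) :
    IsUnit (L.inv u) :=
  ⟨⟨L.inv u, L.toFun u, L.inv_mul u, L.mul_inv u⟩, rfl⟩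

/-- **The pulled-back, based family** of a family `F` of loops on the circle:
`(s, x) ↦ F_s(ptB)⁻¹ F_s(circleParam x)`. [cite: GompfStipsiczGSM1999, §5.2] -/
def famJ (a b : ℝ) (F : ℝ → OpLoop) (s x : ℝ) : 𝔼 3 →L[ℝ] 𝔼 3 :=
  (F s).inv ptB * (F s).toFun (circleParam a b x)

/-- The pulled-back based family of an `OpLoop.Joined` family is a based loop family.
[folklore] -/
theorem isLoopFamily_famJ {a b : ℝ} (ha : 0 < a) (hab : a < b) {F : ℝ → OpLoop}
    (hF : ContinuousOn (fun p : ℝ × (𝕊 1) => (F p.1).toFun p.2) (Icc 0 1 ×ˢ univ))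
    (hFi : ContinuousOn (fun p : ℝ × (𝕊 1) => (F p.1).inv p.2) (Icc 0 1 ×ˢ univ)) :
    IsLoopFamily b (famJ a b F) where
  contDiff s := by
    have h1 : ContMDiff 𝓘(ℝ, ℝ) 𝓘(ℝ, 𝔼 3 →L[ℝ] 𝔼 3) ∞ fun x => (F s).toFun (circleParam a b x) :=
      (F s).contMDiff_toFun.comp (contMDiff_circleParam)
    exact contDiff_const.mul (contMDiff_iff_contDiff.1 h1)
  continuousOn := by
    have h1 : ContinuousOn (fun p : ℝ × ℝ => (F p.1).inv ptB) (Icc (0 : ℝ) 1 ×ˢ univ) :=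
      hFi.comp (continuous_fst.prodMk continuous_const).continuousOn
        fun p hp => ⟨hp.1, mem_univ _⟩
    have h2 : ContinuousOn (fun p : ℝ × ℝ => (F p.1).toFun (circleParam a b p.2))
        (Icc (0 : ℝ) 1 ×ˢ univ) :=
      hF.comp (continuous_fst.prodMk ((continuous_circleParam).comp continuous_snd)).continuousOn
        fun p hp => ⟨hp.1, mem_univ _⟩
    exact h1.mul h2
  isUnit s x := ((F s).isUnit_inv ptB).mul ((F s).isUnit_toFun _)
  eq_one s x hx := by
    rw [famJ, circleParam_of_le_abs ha hab hx, (F s).inv_mul]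

/-- The conjugate of a based loop family by the axis permutation is a based loop family.
[folklore] -/
theorem isLoopFamily_conj {b : ℝ} {B : ℝ → ℝ → (𝔼 3 →L[ℝ] 𝔼 3)} (hB : IsLoopFamily b B) :
    IsLoopFamily b fun s x => perm * B s x * permInv where
  contDiff s := (contDiff_const.mul (hB.contDiff s)).mul contDiff_const
  continuousOn := (continuousOn_const.mul hB.continuousOn).mul continuousOn_const
  isUnit s x := (isUnit_perm.mul (hB.isUnit s x)).mul isUnit_permInv
  eq_one s x hx := by simp only [hB.eq_one s x hx, mul_one, perm_mul_permInv]

/-- **The angle family**: interpolation of rotation angles from `liftAngle x + π` to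
`twistAngle 1 x`. [folklore] -/
def famR (a b : ℝ) (s x : ℝ) : 𝔼 3 →L[ℝ] 𝔼 3 :=
  rot ((1 - s) * (liftAngle a b x + π) + s * twistAngle 1 x)

/-- The angle family is a based loop family (for `a < b`, `1/2 ≤ b`). [folklore] -/
theorem isLoopFamily_famR {a b : ℝ} (ha : 0 < a) (hab : a < b) (hb : 1 / 2 ≤ b) :
    IsLoopFamily b (famR a b) where
  contDiff s := by
    unfold famR
    exact contDiff_rot.comp ((contDiff_const.mul (contDiff_liftAngle.add
      contDiff_const)).add (contDiff_const.mul (contDiff_twistAngle 1)))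
  continuousOn := by
    refine Continuous.continuousOn ?_
    unfold famR
    refine (contDiff_rot (n := 0)).continuous.comp ?_
    exact ((continuous_const.sub continuous_fst).mul
      ((contDiff_liftAngle.continuous.comp continuous_snd).add continuous_const)).add
      (continuous_fst.mul ((contDiff_twistAngle 1).continuous.comp continuous_snd))
  isUnit s x := isUnit_rot _
  eq_one s x hx := by
    unfold famR
    rcases le_or_gt 0 x with h0 | h0
    · rw [abs_of_nonneg h0] at hx
      rw [liftAngle_of_ge ha hab hx, twistAngle_of_ge (hb.trans hx),
        show (1 - s) * (π + π) + s * (2 * π * ((1 : ℤ) : ℝ)) = 2 * π * ((1 : ℤ) : ℝ) by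
          push_cast; ring, rot_int_mul_two_pi]
    · rw [abs_of_neg h0] at hx
      rw [liftAngle_of_le ha hab (by linarith), twistAngle_of_le (by linarith),
        rot_eq_one_of_eq_zero (by ring)]

/-- The angle family starts at the rotation loop `rot (liftAngle x + π)`. [folklore] -/
theorem famR_zero (a b : ℝ) : famR a b 0 = fun x => rot (liftAngle a b x + π) := by
  funext x; simp [famR]

/-- The angle family ends at the twist loop `rot (twistAngle 1 x)`. [folklore] -/
theorem famR_one (a b : ℝ) : famR a b 1 = fun x => rot (twistAngle 1 x) := by
  funext x; simp [famR]

/-! ### The deformation to the standard twist -/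

/-- **A smooth based loop in `GL⁺(3, ℝ)` on the line deforms, relative to the ends, to the
standard twist loop or to the identity.**  Let `A : ℝ → GL(3, ℝ)` be smooth with `A x = 1` for
`|x| ≥ a` (`0 < a < 1`), and let `a < b`, `1/2 ≤ b`.  Then for some `m ∈ ℤ` (in fact
`m ∈ {0, 1}`) there are two based loop families `B₁`, `B₂` (smooth loops, the identity for
`|x| ≥ b`, jointly continuous in `s ∈ [0, 1]`) with `B₁ 0 = A`, `B₁ 1 = B₂ 0` and
`B₂ 1 = (x ↦ rot (twistAngle m x))`, the twist loop of `OneHandleModel.lean`.  (The class of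
`A` in `π₁(GL⁺(3, ℝ), 1) = π₁ SO(3) = ℤ/2`, Gompf–Stipsicz §5.2, via the tree's
`OpLoop.exists_joined_one_or_twist`.) [cite: GompfStipsiczGSM1999, §5.2] -/
theorem exists_loopFamilies_twist {A : ℝ → (𝔼 3 →L[ℝ] 𝔼 3)} (hA : ContDiff ℝ ∞ A) {a b : ℝ}
    (ha : 0 < a) (ha1 : a < 1) (hab : a < b) (hb : 1 / 2 ≤ b)
    (hAI : ∀ x, a ≤ |x| → A x = 1) (hAu : ∀ x, IsUnit (A x)) :
    ∃ (m : ℤ) (B₁ B₂ : ℝ → ℝ → (𝔼 3 →L[ℝ] 𝔼 3)), IsLoopFamily b B₁ ∧ IsLoopFamily b B₂ ∧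
      B₁ 0 = A ∧ B₁ 1 = B₂ 0 ∧ B₂ 1 = fun x => rot (twistAngle m x) := by
  -- the conjugated loop `A' = perm⁻¹ A perm`
  set A' : ℝ → (𝔼 3 →L[ℝ] 𝔼 3) := fun x => permInv * A x * perm with hA'
  have hA's : ContDiff ℝ ∞ A' := (contDiff_const.mul hA).mul contDiff_const
  have hA'I : ∀ x, a ≤ |x| → A' x = 1 := fun x hx => by
    simp only [hA', hAI x hx, mul_one, permInv_mul_perm]
  have hA'u : ∀ x, IsUnit (A' x) := fun x => (isUnit_permInv.mul (hAu x)).mul isUnit_perm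
  -- read on the circle, it is a loop of positive determinant
  set L : OpLoop := circleLoop hA's ha.le ha1 hA'I hA'u with hL
  have hLfun : L.toFun = circleLoopFun A' := rfl
  have hdet : 0 < LinearMap.det (L.toFun ptA : 𝔼 3 →ₗ[ℝ] 𝔼 3) := by
    rw [hLfun, circleLoopFun_ptA]
    exact det_pos_of_isUnit_of_eq_one hA's.continuous hA'u (hA'I a (le_abs_self a)) 0
  have hLinv : L.inv ptB = 1 := by
    show Ring.inverse (circleLoopFun A' ptB) = 1
    rw [circleLoopFun_ptB, Ring.inverse_one]
  -- the pulled-back based family of a joined family starts at `A'`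
  have hstart : ∀ {F : ℝ → OpLoop}, F 0 = L → famJ a b F 0 = A' := fun {F} hF0 => by
    funext x
    rw [famJ, hF0, hLinv, one_mul, hLfun, circleLoopFun_circleParam ha hab ha1 hA'I]
  rcases L.exists_joined_one_or_twist hdet with ⟨F, hFc, hFi, hF0, hF1⟩ | ⟨F, hFc, hFi, hF0, hF1⟩
  · -- null-homotopic: end at the identity loop, `m = 0`
    refine ⟨0, fun s x => perm * famJ a b F s x * permInv, fun _ _ => 1,
      isLoopFamily_conj (isLoopFamily_famJ ha hab hFc hFi), isLoopFamily_one b, ?_, ?_, ?_⟩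
    · funext x
      show perm * famJ a b F 0 x * permInv = A x
      rw [hstart hF0]
      exact perm_conj_permInv_conj (A x)
    · funext x
      show perm * famJ a b F 1 x * permInv = 1
      rw [famJ, hF1]
      show perm * ((1 : 𝔼 3 →L[ℝ] 𝔼 3) * 1) * permInv = 1
      rw [mul_one, mul_one, perm_mul_permInv]
    · funext x
      rw [twistAngle, Int.cast_zero, mul_zero, zero_mul, rot_eq_one_of_eq_zero rfl]
  · -- the twist: end at the standard twist loop, `m = 1`
    refine ⟨1, fun s x => perm * famJ a b F s x * permInv, famR a b,
      isLoopFamily_conj (isLoopFamily_famJ ha hab hFc hFi), isLoopFamily_famR ha hab hb,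
      ?_, ?_, famR_one a b⟩
    · funext x
      show perm * famJ a b F 0 x * permInv = A x
      rw [hstart hF0]
      exact perm_conj_permInv_conj (A x)
    · funext x
      show perm * famJ a b F 1 x * permInv = famR a b 0 x
      rw [famR, famJ, hF1]
      show perm * (OpLoop.twist.inv ptB * OpLoop.twist.toFun (circlePoint (liftAngle a b x))) *
        permInv = _
      rw [twist_inv_ptB_mul_twist_circlePoint, perm_mul_rotZ_mul_permInv]
      congr 1
      ring

/-! ## Part II — fibre-linear self-maps and the ambient realisation of loop families -/

/-! ### The core arc -/

/-- The **core arc** `{(x, 0, 0, 0) : |x| ≤ 1}` of the model `1`-handle. [cite: HirschDT1976, Ch. 4 §5] -/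
def coreArc : Set (𝔼 4) := {p | |lon p| ≤ 1 ∧ fib p = 0}

/-- Membership in the core arc (definitional). [folklore] -/
theorem mem_coreArc {p : 𝔼 4} : p ∈ coreArc ↔ |lon p| ≤ 1 ∧ fib p = 0 := Iff.rfl

/-- `mk x 0` lies on the core arc for `|x| ≤ 1`. [folklore] -/
theorem mk_zero_mem_coreArc {x : ℝ} (hx : |x| ≤ 1) : mk x 0 ∈ coreArc := by
  simp [mem_coreArc, hx]

/-- The core arc is compact. [folklore] -/
theorem isCompact_coreArc : IsCompact coreArc := by
  have hcl : IsClosed coreArc :=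
    (isClosed_le (continuous_abs.comp lon.continuous) continuous_const).inter
      (isClosed_eq fib.continuous continuous_const)
  refine (isCompact_closedBall (0 : 𝔼 4) 1).of_isClosed_subset hcl fun p hp => ?_
  rw [mem_closedBall, dist_zero_right]
  have := norm_le_abs_lon_add_norm_fib p
  rw [hp.2, norm_zero, add_zero] at this
  exact this.trans hp.1

/-- The core arc lies in the solid cylinder. [folklore] -/
theorem coreArc_subset_solidCyl : coreArc ⊆ solidCyl := fun p hp =>
  ⟨hp.1, by rw [hp.2, norm_zero]; exact zero_le_one⟩

/-! ### Fibre-linear self-maps -/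

/-- **The fibre-linear self-map** `p ↦ (p₀, B(p₀) · fibre)` of `ℝ⁴` of a loop `B` of fibre
operators. [cite: HirschDT1976, Ch. 4 §5, Thm. 5.3] -/
def linMap (B : ℝ → (𝔼 3 →L[ℝ] 𝔼 3)) (p : 𝔼 4) : 𝔼 4 := mk (lon p) (B (lon p) (fib p))

/-- The fibre-linear map preserves the longitudinal coordinate. [folklore] -/
@[simp] theorem lon_linMap (B : ℝ → (𝔼 3 →L[ℝ] 𝔼 3)) (p : 𝔼 4) : lon (linMap B p) = lon p := by
  simp [linMap]

/-- The fibre coordinate of the fibre-linear map. [folklore] -/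
@[simp] theorem fib_linMap (B : ℝ → (𝔼 3 →L[ℝ] 𝔼 3)) (p : 𝔼 4) :
    fib (linMap B p) = B (lon p) (fib p) := by
  simp [linMap]

/-- The fibre-linear map of a product of loops is the composite of the fibre-linear maps.
[folklore] -/
theorem linMap_mul_apply (B C : ℝ → (𝔼 3 →L[ℝ] 𝔼 3)) (p : 𝔼 4) :
    linMap (fun x => B x * C x) p = linMap B (linMap C p) := by
  apply ext_lon_fib
  · rw [lon_linMap, lon_linMap, lon_linMap]
  · rw [fib_linMap, fib_linMap, fib_linMap, lon_linMap]
    rfl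

/-- The fibre-linear map of a loop which is `1` at `p₀` fixes `p`. [folklore] -/
theorem linMap_eq_self_of_eq_one {B : ℝ → (𝔼 3 →L[ℝ] 𝔼 3)} {p : 𝔼 4} (h : B (lon p) = 1) :
    linMap B p = p := by
  apply ext_lon_fib
  · rw [lon_linMap]
  · rw [fib_linMap, h]
    rfl

/-- The fibre-linear map of the identity loop is the identity. [folklore] -/
theorem linMap_one (p : 𝔼 4) : linMap (fun _ => (1 : 𝔼 3 →L[ℝ] 𝔼 3)) p = p :=
  linMap_eq_self_of_eq_one rfl

/-- The fibre-linear map fixes the points of the core arc (and of the whole axis). [folklore] -/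
theorem linMap_eq_self_of_fib_eq_zero (B : ℝ → (𝔼 3 →L[ℝ] 𝔼 3)) {p : 𝔼 4} (hp : fib p = 0) :
    linMap B p = p := by
  apply ext_lon_fib
  · rw [lon_linMap]
  · rw [fib_linMap, hp, map_zero]

/-- A smooth loop gives a smooth fibre-linear map. [folklore] -/
theorem contDiff_linMap {B : ℝ → (𝔼 3 →L[ℝ] 𝔼 3)} (hB : ContDiff ℝ ∞ B) :
    ContDiff ℝ ∞ (linMap B) := by
  have h1 : ContDiff ℝ ∞ fun p : 𝔼 4 => B (lon p) (fib p) :=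
    (hB.comp lon.contDiff).clm_apply fib.contDiff
  exact contDiff_mk.comp (lon.contDiff.prodMk h1)

/-- The fibre-linear map is continuous. [folklore] -/
theorem continuous_linMap {B : ℝ → (𝔼 3 →L[ℝ] 𝔼 3)} (hB : ContDiff ℝ ∞ B) :
    Continuous (linMap B) := (contDiff_linMap hB).continuous

/-- **The derivative of the fibre-linear map along the axis**: `w ↦ (w₀, T · fibre w)` for the
fibre operator `T = B(x)`. [folklore] -/
def linMapDeriv (T : 𝔼 3 →L[ℝ] 𝔼 3) : 𝔼 4 →L[ℝ] 𝔼 4 := lon.smulRight e0 + emb.comp (T.comp fib)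

/-- The derivative along the axis in coordinates. [folklore] -/
theorem linMapDeriv_apply (T : 𝔼 3 →L[ℝ] 𝔼 3) (w : 𝔼 4) : linMapDeriv T w = mk (lon w) (T (fib w)) :=
  rfl

/-- **Along the axis the fibre-linear map has derivative `linMapDeriv (B x)`** (the term with the
derivative of `B` is applied to the vanishing fibre coordinate). [folklore] -/
theorem hasFDerivAt_linMap {B : ℝ → (𝔼 3 →L[ℝ] 𝔼 3)} (hB : ContDiff ℝ ∞ B) {p : 𝔼 4}
    (hp : fib p = 0) : HasFDerivAt (linMap B) (linMapDeriv (B (lon p))) p := by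
  have hBd : HasFDerivAt B (fderiv ℝ B (lon p)) (lon p) :=
    ((hB.differentiable (by simp)) _).hasFDerivAt
  have hc : HasFDerivAt (fun q : 𝔼 4 => B (lon q)) ((fderiv ℝ B (lon p)).comp lon) p :=
    hBd.comp p lon.hasFDerivAt
  have h2 : HasFDerivAt (fun q : 𝔼 4 => B (lon q) (fib q)) ((B (lon p)).comp fib) p := by
    have h := hc.clm_apply fib.hasFDerivAt
    rw [hp, map_zero, add_zero] at h
    exact h
  have h3 : HasFDerivAt (fun q : 𝔼 4 => emb (B (lon q) (fib q))) (emb.comp ((B (lon p)).comp fib)) p :=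
    emb.hasFDerivAt.comp p h2
  have h1 : HasFDerivAt (fun q : 𝔼 4 => lon q • e0) (lon.smulRight e0) p :=
    lon.hasFDerivAt.smul_const e0
  exact h1.add h3

/-- A unit of the operator algebra is injective. [folklore] -/
theorem injective_of_isUnit {E : Type*} [NormedAddCommGroup E] [NormedSpace ℝ E]
    {f : E →L[ℝ] E} (h : IsUnit f) : Injective f := by
  obtain ⟨u, rfl⟩ := h
  intro a b hab
  have ha : ((↑u⁻¹ * ↑u : E →L[ℝ] E)) a = a := by rw [Units.inv_mul]; rfl
  have hb : ((↑u⁻¹ * ↑u : E →L[ℝ] E)) b = b := by rw [Units.inv_mul]; rfl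
  rw [← ha, ← hb]
  show (↑u⁻¹ : E →L[ℝ] E) ((u : E →L[ℝ] E) a) = (↑u⁻¹ : E →L[ℝ] E) ((u : E →L[ℝ] E) b)
  rw [hab]

/-- **The straight-line differential `(1 - t) id + t · linMapDeriv M` is injective for
`‖M - 1‖ < 1`, `t ∈ [0, 1]`** (identity in the longitudinal direction, the unit
`1 + t (M - 1)` in the fibre). [folklore] -/
theorem injective_slDeriv_linMapDeriv {M : 𝔼 3 →L[ℝ] 𝔼 3} (hM : ‖M - 1‖ < 1) {t : ℝ}
    (ht : t ∈ Icc (0 : ℝ) 1) : Injective (slDeriv t (linMapDeriv M)) := by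
  -- the fibre factor is a unit
  have hunit : IsUnit (1 + t • (M - 1)) := by
    have hn : ‖-(t • (M - 1))‖ < 1 := by
      rw [norm_neg, norm_smul, Real.norm_eq_abs, abs_of_nonneg ht.1]
      calc t * ‖M - 1‖ ≤ 1 * ‖M - 1‖ := mul_le_mul_of_nonneg_right ht.2 (norm_nonneg _)
        _ < 1 := by rw [one_mul]; exact hM
    have := (Units.oneSub (-(t • (M - 1))) hn).isUnit
    simpa using this
  intro v w hvw
  -- a linear map: reduce to the kernel
  rw [← sub_eq_zero] at hvw ⊢
  rw [← map_sub] at hvw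
  set u := v - w with hu
  have hlon : lon u = 0 := by
    have := congrArg lon hvw
    simpa [slDeriv_apply, linMapDeriv_apply] using this
  have hfib : (1 + t • (M - 1)) (fib u) = 0 := by
    have := congrArg fib hvw
    simp only [slDeriv_apply, linMapDeriv_apply, map_add, map_smul, map_sub, fib_mk, map_zero] at this
    simpa [add_comm, smul_sub] using this
  have hfib0 : fib u = 0 := by
    have hinj := injective_of_isUnit hunit
    rw [← map_zero (1 + t • (M - 1))] at hfib
    exact hinj hfib
  rw [← mk_lon_fib u, hlon, hfib0]
  simp [mk]

/-! ### One near-identity step -/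

/-- **Ambient realisation of one near-identity fibre-linear step near the core, relative to the
ends.**  Let `B`, `C` be smooth loops of fibre operators, `B` of units, both `= 1` for `|x| ≥ c₀`,
with `‖C(x) B(x)⁻¹ - 1‖ < 1` for all `x`; let `O` be an open neighbourhood of the core arc and
`Cs` a set of points with `|p₀| ≥ c₀`.  Then there is a diffeomorphism `Q` of `ℝ⁴` with
`Q ∘ linMap B = linMap C` on a neighbourhood of the core arc, `Q = id` off `O` and `Q = id` on
`Cs` — the isotopy extension theorem for the straight-line isotopy from `id` to
`linMap (C B⁻¹)` (Hirsch (1976), Ch. 8 §1, Thms. 1.3–1.4; tree: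
`exists_diffeomorph_eqOn_nhdsSet_of_straightLine_rel`). [cite: HirschDT1976, Ch. 8 §1, Thm. 1.3] -/
theorem exists_diffeomorph_linMap_step {B C : ℝ → (𝔼 3 →L[ℝ] 𝔼 3)} (hB : ContDiff ℝ ∞ B)
    (hC : ContDiff ℝ ∞ C) (hBu : ∀ x, IsUnit (B x)) {c₀ : ℝ}
    (hB1 : ∀ x, c₀ ≤ |x| → B x = 1) (hC1 : ∀ x, c₀ ≤ |x| → C x = 1)
    (hclose : ∀ x, ‖C x * Ring.inverse (B x) - 1‖ < 1)
    {O : Set (𝔼 4)} (hO : IsOpen O) (hZO : coreArc ⊆ O)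
    {Cs : Set (𝔼 4)} (hCs : ∀ p ∈ Cs, c₀ ≤ |lon p|) :
    ∃ Q : 𝔼 4 ≃ₘ⟮𝓘(ℝ, 𝔼 4), 𝓘(ℝ, 𝔼 4)⟯ 𝔼 4,
      (∀ᶠ p in 𝓝ˢ coreArc, Q (linMap B p) = linMap C p) ∧
      (∀ p, p ∉ O → Q p = p) ∧ (∀ p ∈ Cs, Q p = p) := by
  -- the loop `M = C B⁻¹` and the map `P = linMap M`
  set M : ℝ → (𝔼 3 →L[ℝ] 𝔼 3) := fun x => C x * Ring.inverse (B x) with hM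
  have hMs : ContDiff ℝ ∞ M := by
    refine hC.mul (contDiff_iff_contDiffAt.2 fun x => ?_)
    have h1 : ContDiffAt ℝ ∞ Ring.inverse (B x) := by
      have := contDiffAt_ringInverse ℝ (n := ∞) (hBu x).unit
      rwa [IsUnit.unit_spec] at this
    exact h1.comp x hB.contDiffAt
  have hMB : ∀ x, M x * B x = C x := fun x => by
    simp only [hM, mul_assoc, Ring.inverse_mul_cancel _ (hBu x), mul_one]
  have hM1 : ∀ x, c₀ ≤ |x| → M x = 1 := fun x hx => by
    simp only [hM, hB1 x hx, hC1 x hx, Ring.inverse_one, mul_one]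
  set P : 𝔼 4 → 𝔼 4 := linMap M with hP
  have hPs : ContDiffOn ℝ ∞ P univ := (contDiff_linMap hMs).contDiffOn
  have hPZ : ∀ z ∈ coreArc, P z = z := fun z hz => linMap_eq_self_of_fib_eq_zero M hz.2
  have hD : ∀ z ∈ coreArc, HasFDerivAt P (linMapDeriv (M (lon z))) z := fun z hz =>
    hasFDerivAt_linMap hMs hz.2
  have hinj : ∀ z ∈ coreArc, ∀ t ∈ Icc (0 : ℝ) 1,
      Injective (slDeriv t (linMapDeriv (M (lon z)))) := fun z _ t ht =>
    injective_slDeriv_linMapDeriv (hclose (lon z)) ht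
  -- the tracks preserve `p₀`, so only stationary tracks visit `Cs`
  have hlonP : ∀ y, lon (P y) = lon y := fun y => lon_linMap M y
  have hCs' : ∀ᶠ y in 𝓝ˢ coreArc, ∀ t ∈ Icc (-1 : ℝ) 2, slIsotopy P t y ∈ Cs → P y = y := by
    refine Filter.Eventually.of_forall fun y t _ hy => ?_
    have hl : lon (slIsotopy P t y) = lon y := by
      rw [slIsotopy, map_add, map_smul, map_sub, hlonP y, sub_self, smul_zero, add_zero]
    have := hCs _ hy
    rw [hl] at this
    exact linMap_eq_self_of_eq_one (hM1 _ this)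
  obtain ⟨Q, hQP, hQO, hQC, -⟩ := exists_diffeomorph_eqOn_nhdsSet_of_straightLine_rel
    isCompact_coreArc isOpen_univ (subset_univ _) hPs hPZ hD hinj hO hZO hCs'
  refine ⟨Q, ?_, hQO, hQC⟩
  -- `Q = P` on an open `U ⊇ coreArc`; `linMap B` maps a neighbourhood of the arc into `U`
  obtain ⟨U, hU, hZU, hUP⟩ := mem_nhdsSet_iff_exists.1 hQP
  have hpre : (linMap B) ⁻¹' U ∈ 𝓝ˢ coreArc := by
    refine (hU.preimage (continuous_linMap hB)).mem_nhdsSet.2 fun z hz => ?_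
    show linMap B z ∈ U
    rw [linMap_eq_self_of_fib_eq_zero B hz.2]
    exact hZU hz
  refine Filter.eventually_of_mem hpre fun p hp => ?_
  rw [show Q (linMap B p) = P (linMap B p) from hUP hp, hP, ← linMap_mul_apply]
  congr 1
  exact funext hMB

/-! ### The whole deformation, in finitely many near-identity steps -/

/-- **Uniform closeness of consecutive loops of a based loop family**: for a based loop family
`B` there is `N ≥ 1` with `‖B((j+1)/N, x) B(j/N, x)⁻¹ - 1‖ < 1` for all `j < N` and all `x`
(uniform continuity of `(s, s', x) ↦ B(s', x) B(s, x)⁻¹`, which is `1` on the diagonal, on the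
compact `[0, 1]² × [-|b| - 1, |b| + 1]`, outside of which the loops are the identity). [folklore] -/
theorem exists_steps_of_isLoopFamily {b : ℝ} {B : ℝ → ℝ → (𝔼 3 →L[ℝ] 𝔼 3)}
    (hB : IsLoopFamily b B) : ∃ N : ℕ, 0 < N ∧ ∀ j : ℕ, j < N → ∀ x : ℝ,
      ‖B ((j + 1 : ℕ) / N) x * Ring.inverse (B ((j : ℕ) / N) x) - 1‖ < 1 := by
  set K : Set (ℝ × ℝ × ℝ) := Icc (0 : ℝ) 1 ×ˢ (Icc (0 : ℝ) 1 ×ˢ Icc (-(|b| + 1)) (|b| + 1))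
    with hK
  have hKc : IsCompact K := isCompact_Icc.prod (isCompact_Icc.prod isCompact_Icc)
  -- the comparison operators `Φ (s, s', x) = B(s', x) B(s, x)⁻¹`
  set Φ : ℝ × ℝ × ℝ → (𝔼 3 →L[ℝ] 𝔼 3) := fun q => B q.2.1 q.2.2 * Ring.inverse (B q.1 q.2.2)
    with hΦ
  have hB1 : ContinuousOn (fun q : ℝ × ℝ × ℝ => B q.2.1 q.2.2) K := by
    refine hB.continuousOn.comp (continuous_snd).continuousOn fun q hq => ⟨hq.2.1, mem_univ _⟩
  have hB2 : ContinuousOn (fun q : ℝ × ℝ × ℝ => B q.1 q.2.2) K := by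
    refine hB.continuousOn.comp
      (continuous_fst.prodMk (continuous_snd.comp continuous_snd)).continuousOn
      fun q hq => ⟨hq.1, mem_univ _⟩
  have hΦc : ContinuousOn Φ K := by
    refine hB1.mul fun q hq => ?_
    have hu : IsUnit (B q.1 q.2.2) := hB.isUnit _ _
    have h1 : ContinuousAt Ring.inverse (B q.1 q.2.2) := by
      have := NormedRing.inverse_continuousAt hu.unit
      rwa [IsUnit.unit_spec] at this
    exact ContinuousAt.comp_continuousWithinAt (f := fun q : ℝ × ℝ × ℝ => B q.1 q.2.2) h1 (hB2 q hq)
  -- uniform continuity of `Φ` on `K`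
  have huc := hKc.uniformContinuousOn_of_continuous hΦc
  rw [Metric.uniformContinuousOn_iff] at huc
  obtain ⟨δ, hδ, hδΦ⟩ := huc 1 one_pos
  obtain ⟨N, hN⟩ := exists_nat_one_div_lt hδ
  have hN0 : 0 < N + 1 := Nat.succ_pos N
  refine ⟨N + 1, hN0, fun j hj x => ?_⟩
  have hNR : (0 : ℝ) < (N + 1 : ℕ) := by exact_mod_cast hN0
  -- far out everything is `1`
  by_cases hx : b ≤ |x|
  · rw [hB.eq_one _ _ hx, hB.eq_one _ _ hx, Ring.inverse_one, mul_one, sub_self, norm_zero]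
    exact one_pos
  · -- abbreviate the two times
    obtain ⟨s₁, hs₁⟩ : ∃ s : ℝ, s = ((j : ℕ) : ℝ) / (N + 1 : ℕ) := ⟨_, rfl⟩
    obtain ⟨s₂, hs₂⟩ : ∃ s : ℝ, s = ((j + 1 : ℕ) : ℝ) / (N + 1 : ℕ) := ⟨_, rfl⟩
    rw [← hs₁, ← hs₂]
    have hxK : x ∈ Icc (-(|b| + 1)) (|b| + 1) := by
      rw [not_le] at hx
      have : |x| < |b| + 1 := by linarith [le_abs_self b]
      constructor <;> linarith [neg_abs_le x, le_abs_self x]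
    have hs1 : s₁ ∈ Icc (0 : ℝ) 1 := by
      rw [hs₁]
      refine ⟨by positivity, ?_⟩
      rw [div_le_one hNR]; exact_mod_cast hj.le
    have hs2 : s₂ ∈ Icc (0 : ℝ) 1 := by
      rw [hs₂]
      refine ⟨by positivity, ?_⟩
      rw [div_le_one hNR]; exact_mod_cast hj
    have hq : (s₁, s₂, x) ∈ K := ⟨hs1, hs2, hxK⟩
    have hq' : (s₁, s₁, x) ∈ K := ⟨hs1, hs1, hxK⟩
    have hdist : dist (s₁, s₂, x) (s₁, s₁, x) < δ := by
      have hd : dist (s₁, s₂, x) (s₁, s₁, x) = |s₂ - s₁| := by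
        simp only [Prod.dist_eq, dist_self, Real.dist_eq]
        rw [max_eq_left (abs_nonneg (s₂ - s₁)), max_eq_right (abs_nonneg (s₂ - s₁))]
      rw [hd]
      have : s₂ - s₁ = 1 / (N + 1 : ℕ) := by
        rw [hs₁, hs₂]; push_cast; field_simp; ring
      rw [this, abs_of_pos (by positivity)]
      push_cast at hN ⊢
      exact hN
    have h := hδΦ _ hq _ hq' hdist
    -- on the diagonal `Φ = 1`
    have hdiag : Φ (s₁, s₁, x) = 1 := Ring.mul_inverse_cancel _ (hB.isUnit _ _)
    rw [hdiag, dist_eq_norm] at h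
    exact h

/-- **Ambient realisation, near the core and relative to the ends, of a deformation of
fibre-linear loops.**  Let `B` be a based loop family (`OneHandle.IsLoopFamily b`: smooth loops
of invertible fibre operators, the identity for `|x| ≥ b`, jointly continuous in `s ∈ [0, 1]`),
`O` an open neighbourhood of the core arc and `Cs` a set of points with `|p₀| ≥ b`.  Then there
is a diffeomorphism `Q` of `ℝ⁴` with `Q ∘ linMap (B 0) = linMap (B 1)` on a neighbourhood of the
core arc, `Q = id` off `O` and `Q = id` on `Cs` (finitely many near-identity steps,
`exists_diffeomorph_linMap_step`, composed). [cite: HirschDT1976, Ch. 8 §1, Thm. 1.3] -/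
theorem exists_diffeomorph_linMap_of_isLoopFamily {b : ℝ} {B : ℝ → ℝ → (𝔼 3 →L[ℝ] 𝔼 3)}
    (hB : IsLoopFamily b B) {O : Set (𝔼 4)} (hO : IsOpen O) (hZO : coreArc ⊆ O)
    {Cs : Set (𝔼 4)} (hCs : ∀ p ∈ Cs, b ≤ |lon p|) :
    ∃ Q : 𝔼 4 ≃ₘ⟮𝓘(ℝ, 𝔼 4), 𝓘(ℝ, 𝔼 4)⟯ 𝔼 4,
      (∀ᶠ p in 𝓝ˢ coreArc, Q (linMap (B 0) p) = linMap (B 1) p) ∧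
      (∀ p, p ∉ O → Q p = p) ∧ (∀ p ∈ Cs, Q p = p) := by
  obtain ⟨N, hN, hstep⟩ := exists_steps_of_isLoopFamily hB
  -- induction on the number of steps performed
  have key : ∀ j : ℕ, j ≤ N → ∃ Q : 𝔼 4 ≃ₘ⟮𝓘(ℝ, 𝔼 4), 𝓘(ℝ, 𝔼 4)⟯ 𝔼 4,
      (∀ᶠ p in 𝓝ˢ coreArc, Q (linMap (B 0) p) = linMap (B ((j : ℕ) / N)) p) ∧
      (∀ p, p ∉ O → Q p = p) ∧ (∀ p ∈ Cs, Q p = p) := by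
    intro j
    induction j with
    | zero =>
      intro _
      refine ⟨Diffeomorph.refl _ _ _, Filter.Eventually.of_forall fun p => ?_, fun p _ => rfl,
        fun p _ => rfl⟩
      simp
    | succ j ih =>
      intro hj
      obtain ⟨R, hR, hRO, hRC⟩ := ih (Nat.le_of_succ_le hj)
      obtain ⟨Q, hQ, hQO, hQC⟩ := exists_diffeomorph_linMap_step (hB.contDiff _) (hB.contDiff _)
        (hB.isUnit _) (hB.eq_one _) (hB.eq_one _) (hstep j hj) hO hZO hCs
      refine ⟨R.trans Q, ?_, fun p hp => ?_, fun p hp => ?_⟩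
      · filter_upwards [hR, hQ] with p hpR hpQ
        rw [Diffeomorph.coe_trans, Function.comp_apply, hpR, hpQ]
      · rw [Diffeomorph.coe_trans, Function.comp_apply, hRO p hp, hQO p hp]
      · rw [Diffeomorph.coe_trans, Function.comp_apply, hRC p hp, hQC p hp]
  obtain ⟨Q, hQ, hQO, hQC⟩ := key N le_rfl
  refine ⟨Q, ?_, hQO, hQC⟩
  have hNN : ((N : ℕ) : ℝ) / N = 1 := div_self (by exact_mod_cast hN.ne')
  simpa [hNN] using hQ

end OneHandle

end Literature.Topology.FourManifolds

end
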